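import Mathlib
import Summits.RiemannHypothesis.RiemannHypothesis.Theorems.WeilFarCoercivityFloor
import Literature.NumberTheory.LFunctions.WeilMarkovQuadratic
import Literature.NumberTheory.LFunctions.WeilExplicitProofs
import Literature.NumberTheory.LFunctions.WeilExplicitFormulaProofs
import Literature.NumberTheory.LFunctions.WeilWindowSuzukiProofs
import Literature.NumberTheory.LFunctions.WeilArchDensityTail
import Literature.NumberTheory.LFunctions.WeilArchTailPanels
import Literature.NumberTheory.LFunctions.WeilBochnerRepresentationRH
import Literature.Analysis.SpecialFunctions.DigammaReflection
import Summits.RiemannHypothesis.RiemannHypothesis.Theorems.WeilGroundStateGroundStateSimpleEvenKillingIntegral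
import HarnessLib

/-!
# The prime-shift form UNDER RH: pole − killing + archimedean energy (explicit-formula anatomy of the floor)

Helper file (`--supports stmt-RiemannHypothesis-0098`, lead-track anchor: Weil-positivity window ladder, format-C far bound),
pure proofs.  Seat rh-explicit-weil-1 gen10 (memo `run/shared/lean/pub/rh-explicit/rh-explicit-weil-1/FORMAT-K3.md` §11).
The far-coercivity floor `λ_max(a)` (`WeilFarCoercivityFloor`) is the top of the prime-shift form
`Q_a(g) = Σ_{log n < 2a} 2(Λ(n)/√n)∫g(x − log n)g(x)dx` on the `L²`-unit sphere of the window `[−a, a]`.  By Bombieri's form of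
the explicit formula as a pure-jump Dirichlet form (Literature `WeilMarkovQuadratic`: `Re Q(G) = P(G) + 𝓔_a(G) − M_a‖G‖²`)
and the easy half of Weil's criterion (`WeilPositivity.of_riemannHypothesis`: RH ⇒ `Re Q(G) ≥ 0`), for every REAL smooth `g`
supported in `[−a, a]` (with `G = g` viewed in `ℂ`, `D_t(G) = ∫|g(x+t) − g(x)|²`, `ρ_∞(t) = e^{t/2}/(2 sinh t)`,
`I₀ = ∫₀^∞ (e^{t/2} − 1)/(2 sinh t) dt`):
§1 `Q_a(g) = Σ_{log n<2a} (Λ(n)/√n)(2‖g‖² − D_{log n}(G))` (`primeShiftForm_eq_sum_weilIncrement`);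
§2 UNDER RH **`Q_a(g) + (2I₀ + log 4π + γ)‖g‖² + 2(∫g·sinh(·/2))² ≤ 2(∫g·cosh(·/2))² + ∫₀^∞ ρ_∞(t) D_t(G) dt`**
(`primeShiftForm_add_le_of_RH`): prime-shift form ≤ rank-two POLE form − KILLING constant + ARCHIMEDEAN Dirichlet energy
(what is dropped is exactly the zero side `Σ_γ |ĝ(½ + iγ)|² ≥ 0`);
§3 with Cauchy–Schwarz on the window, `2(∫g·cosh(·/2))² ≤ 2(a + sinh a)‖g‖² = (e^a + 2a − e^{−a})‖g‖²`:
**`Q_a(g) ≤ (e^a + 2a − e^{−a} − 2I₀ − log 4π − γ)‖g‖² + ∫₀^∞ ρ_∞ D_t(G) dt`** (`primeShiftForm_le_of_RH`) — UNDER RH the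
UPPER clause of the floor law C-XIII (`λ_max(a) ≤ pntFloor a − 2γ + C`, `pntFloor a = e^a + 2a − 2 + o(1)`) is EQUIVALENT to an
`O(‖g‖²)` bound, uniform in `a`, on the archimedean excess `∫₀^∞ ρ_∞(t)(D_t(G) − 2(1 − e^{−t/2})‖g‖²)dt` of near-extremal `g`
(a small-scale REGULARITY statement: `ρ_∞(t) ~ 1/(2t)` at `0⁺`), since for the boundary profile `e^{−|a−x|/2}` that excess
vanishes and `2I₀`, `log 4π + γ = 2 + 2γ − β` (`β = Σ_ρ 1/|ρ|²`) reproduce the law's constant.  Standard axioms only; RH enters as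
Mathlib's `RiemannHypothesis` hypothesis.
-/

set_option linter.dupNamespace false
set_option autoImplicit false

noncomputable section

open MeasureTheory Set Filter Topology
open scoped Real BigOperators ArithmeticFunction.vonMangoldt

namespace Summit.RiemannHypothesis.RiemannHypothesis.Theorems.WeilFormatC

namespace FloorAnatomy

open Literature.NumberTheory.LFunctions

variable {a : ℝ} {g : ℝ → ℝ}

/-! ## §1 The prime-shift form of a real test function through increments -/

/-- A real function whose complexification is a Weil test function is continuous with compact support. -/
theorem continuous_and_hasCompactSupport (hG : IsWeilTest fun x ↦ (g x : ℂ)) : Continuous g ∧ HasCompactSupport g := by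
  refine ⟨(Complex.continuous_re.comp hG.1.continuous).congr fun x ↦ by simp, ?_⟩
  have h : (fun x ↦ g x) = fun x ↦ ((fun x ↦ (g x : ℂ)) x).re := funext fun x ↦ by simp
  rw [show g = fun x ↦ g x from rfl, h]
  exact hG.2.comp_left Complex.zero_re

/-- Off `[−a, a]` a test function of the window vanishes. -/
theorem eq_zero_of_not_mem (hsub : tsupport (fun x ↦ (g x : ℂ)) ⊆ Icc (-a) a) {x : ℝ} (hx : x ∉ Icc (-a) a) : g x = 0 := by
  have h : (fun x ↦ (g x : ℂ)) x = 0 := image_eq_zero_of_notMem_tsupport (f := fun x ↦ (g x : ℂ)) fun h ↦ hx (hsub h)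
  have h' : (g x : ℂ) = 0 := h
  exact_mod_cast h'

/-- **`D_t(G) = 2‖g‖² − 2∫ g(x − t)g(x) dx`** for a real continuous compactly supported `g` (`G = g` in `ℂ`,
`D_t(G) = ∫|g(x+t) − g(x)|²` the increment form of Literature `WeilMarkovQuadratic`). -/
theorem weilIncrement_ofReal (hg : Continuous g) (hsupp : HasCompactSupport g) (t : ℝ) :
    weilIncrement (fun x ↦ (g x : ℂ)) t = 2 * (∫ x, g x ^ 2) - 2 * ∫ x, g (x - t) * g x := by
  rw [weilIncrement_eq_integral_sub]
  have h1 : ∀ u : ℝ, ‖((g u : ℂ)) - (g (u - t) : ℂ)‖ ^ 2 = g u * g u - 2 * (g (u - t) * g u) + g (u - t) * g (u - t) :=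
    fun u ↦ by rw [← Complex.ofReal_sub, Complex.norm_real, Real.norm_eq_abs, sq_abs]; ring
  simp_rw [h1]
  have hgt : Continuous fun u ↦ g (u - t) := hg.comp (continuous_id.sub continuous_const)
  have hgt_supp : HasCompactSupport fun u ↦ g (u - t) := by
    have : (fun u ↦ g (u - t)) = g ∘ Homeomorph.addRight (-t) := funext fun u ↦ by simp [sub_eq_add_neg]
    rw [this]
    exact hsupp.comp_homeomorph _
  have i1 : Integrable fun u ↦ g u * g u := (hg.mul hg).integrable_of_hasCompactSupport hsupp.mul_right
  have i2 : Integrable fun u ↦ g (u - t) * g u := (hgt.mul hg).integrable_of_hasCompactSupport hsupp.mul_left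
  have i3 : Integrable fun u ↦ g (u - t) * g (u - t) := (hgt.mul hgt).integrable_of_hasCompactSupport hgt_supp.mul_right
  have i2' : Integrable fun u ↦ 2 * (g (u - t) * g u) := i2.const_mul 2
  have i12 : Integrable fun u ↦ g u * g u - 2 * (g (u - t) * g u) := i1.sub i2'
  rw [integral_add i12 i3, integral_sub i1 i2', integral_const_mul, integral_sub_right_eq_self (fun u ↦ g u * g u) t]
  simp_rw [pow_two]
  ring

/-- **The prime-shift form through increments**: `Q_a(g) = Σ_{log n < 2a} (Λ(n)/√n)·(2‖g‖² − D_{log n}(G))`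
(the prime part of Bombieri's Dirichlet-form decomposition, Literature `weilPrimeTerm_weilConv_weilReflect`). -/
theorem primeShiftForm_eq_sum_weilIncrement (hG : IsWeilTest fun x ↦ (g x : ℂ)) :
    primeShiftForm a g = ∑ n ∈ weilPrimeIndex a,
      (Λ n : ℝ) / Real.sqrt n * (2 * (∫ x, g x ^ 2) - weilIncrement (fun x ↦ (g x : ℂ)) (Real.log n)) := by
  obtain ⟨hgc, hgs⟩ := continuous_and_hasCompactSupport hG
  unfold primeShiftForm
  refine Finset.sum_congr rfl fun n _ ↦ ?_
  rw [weilIncrement_ofReal hgc hgs]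
  ring

/-! ## §2 Under RH: prime-shift form ≤ pole form − killing constant + archimedean energy -/

/-- The pole form of a real test function: `P(G) = 2(∫ g·cosh(·/2))² − 2(∫ g·sinh(·/2))²`. -/
theorem weilPoleForm_ofReal (g : ℝ → ℝ) :
    weilPoleForm (fun x ↦ (g x : ℂ)) = 2 * (∫ t, g t * Real.cosh (t / 2)) ^ 2 - 2 * (∫ t, g t * Real.sinh (t / 2)) ^ 2 := by
  have hC : (∫ t, (g t : ℂ) * (Real.cosh (t / 2) : ℂ)) = ((∫ t, g t * Real.cosh (t / 2) : ℝ) : ℂ) := by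
    rw [← integral_complex_ofReal]
    exact integral_congr_ae (ae_of_all _ fun t ↦ by push_cast; ring)
  have hS : (∫ t, (g t : ℂ) * (Real.sinh (t / 2) : ℂ)) = ((∫ t, g t * Real.sinh (t / 2) : ℝ) : ℂ) := by
    rw [← integral_complex_ofReal]
    exact integral_congr_ae (ae_of_all _ fun t ↦ by push_cast; ring)
  rw [weilPoleForm, hC, hS, Complex.norm_real, Complex.norm_real, Real.norm_eq_abs, Real.norm_eq_abs, sq_abs, sq_abs]

/-- **UNDER RH: `Q_a(g) + (2I₀ + log 4π + γ)‖g‖² + 2(∫g·sinh(·/2))² ≤ 2(∫g·cosh(·/2))² + ∫₀^∞ ρ_∞(t)D_t(G)dt`** for every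
real smooth `g` supported in `[−a, a]` (`I₀ = ∫₀^∞ (e^{t/2} − 1)/(2 sinh t) dt`, `ρ_∞(t) = e^{t/2}/(2 sinh t) = weilArchDensity t`):
Bombieri's decomposition `Re Q(G) = P(G) + 𝓔_a(G) − M_a‖G‖²` (Literature `WeilMarkovQuadratic`) with `Re Q(G) ≥ 0`
(RH ⇒ Weil positivity, `WeilPositivity.of_riemannHypothesis` + the tree's explicit formula); the dropped term is the zero side. -/
theorem primeShiftForm_add_le_of_RH (hRH : RiemannHypothesis) (hG : IsWeilTest fun x ↦ (g x : ℂ))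
    (hsub : tsupport (fun x ↦ (g x : ℂ)) ⊆ Icc (-a) a) :
    primeShiftForm a g
        + (2 * (∫ t in Ioi (0 : ℝ), (Real.exp (t / 2) - 1) / (2 * Real.sinh t))
            + (Real.log (4 * π) + Real.eulerMascheroniConstant)) * (∫ x, g x ^ 2)
        + 2 * (∫ t, g t * Real.sinh (t / 2)) ^ 2
      ≤ 2 * (∫ t, g t * Real.cosh (t / 2)) ^ 2
        + ∫ t in Ioi (0 : ℝ), weilArchDensity t * weilIncrement (fun x ↦ (g x : ℂ)) t := by
  have hpos : 0 ≤ (weilQuadratic fun x ↦ (g x : ℂ)).re :=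
    WeilPositivity.of_riemannHypothesis explicit_formula_holds hRH _ hG
  rw [weilQuadratic_re_eq_weilPoleForm_add_weilDirichletEnergy_sub hG hsub, weilPoleForm_ofReal] at hpos
  have hnorm : (∫ x, ‖((g x : ℂ))‖ ^ 2) = ∫ x, g x ^ 2 :=
    integral_congr_ae (ae_of_all _ fun x ↦ by simp only [Complex.norm_real, Real.norm_eq_abs, sq_abs])
  rw [hnorm] at hpos
  unfold weilDirichletEnergy weilMarkovConstant at hpos
  have hQ := primeShiftForm_eq_sum_weilIncrement (a := a) hG
  rw [Finset.mul_sum] at hpos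
  set N := ∫ x, g x ^ 2 with hN
  set E := ∑ n ∈ weilPrimeIndex a, (Λ n : ℝ) / Real.sqrt n * weilIncrement (fun x ↦ (g x : ℂ)) (Real.log n) with hE
  set P := ∑ n ∈ weilPrimeIndex a, (Λ n : ℝ) / Real.sqrt n with hP
  have hQ' : primeShiftForm a g = 2 * N * P - E := by
    rw [hQ, hP, hE, Finset.mul_sum, ← Finset.sum_sub_distrib]
    exact Finset.sum_congr rfl fun n _ ↦ by ring
  have hPN : ∑ n ∈ weilPrimeIndex a, 2 * ((Λ n : ℝ) / Real.sqrt n) = 2 * P := by rw [hP, Finset.mul_sum]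
  rw [hPN] at hpos
  nlinarith [hpos, hQ']

/-! ## §3 The window's Cauchy–Schwarz bound for the pole form, and the RH ceiling -/

/-- `∫_{[−a,a]} cosh²(t/2) dt = a + sinh a` (`cosh²(t/2) = (1 + cosh t)/2`). -/
theorem integral_cosh_half_sq (ha : 0 ≤ a) : ∫ t in Icc (-a) a, Real.cosh (t / 2) ^ 2 = a + Real.sinh a := by
  rw [integral_Icc_eq_integral_Ioc, ← intervalIntegral.integral_of_le (by linarith : -a ≤ a)]
  have hderiv : ∀ x ∈ uIcc (-a) a, HasDerivAt (fun x ↦ x / 2 + Real.sinh x / 2) (Real.cosh (x / 2) ^ 2) x := by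
    intro x _
    have h := ((hasDerivAt_id x).div_const 2).add ((Real.hasDerivAt_sinh x).div_const 2)
    refine h.congr_deriv ?_
    have h2 : Real.cosh x = Real.cosh (2 * (x / 2)) := by ring_nf
    rw [h2, Real.cosh_two_mul, Real.sinh_sq]
    ring
  rw [intervalIntegral.integral_eq_sub_of_hasDerivAt hderiv ((Real.continuous_cosh.comp (continuous_id.div_const 2)).pow 2
    |>.intervalIntegrable _ _)]
  simp only [Real.sinh_neg]
  ring

/-- **Cauchy–Schwarz on the window**: `(∫ g·cosh(·/2))² ≤ (a + sinh a)·‖g‖²` for `g` supported in `[−a, a]` (`a > 0`). -/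
theorem sq_integral_mul_cosh_le (hG : IsWeilTest fun x ↦ (g x : ℂ)) (hsub : tsupport (fun x ↦ (g x : ℂ)) ⊆ Icc (-a) a)
    (ha : 0 < a) : (∫ t, g t * Real.cosh (t / 2)) ^ 2 ≤ (a + Real.sinh a) * ∫ x, g x ^ 2 := by
  obtain ⟨hgc, -⟩ := continuous_and_hasCompactSupport hG
  have hz := fun x (hx : x ∉ Icc (-a) a) ↦ eq_zero_of_not_mem hsub hx
  -- everything lives on the window
  have hB : ∫ t, g t * Real.cosh (t / 2) = ∫ t in Icc (-a) a, g t * Real.cosh (t / 2) :=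
    (setIntegral_eq_integral_of_forall_compl_eq_zero fun x hx ↦ by rw [hz x hx, zero_mul]).symm
  have hN : ∫ x, g x ^ 2 = ∫ x in Icc (-a) a, g x ^ 2 :=
    (setIntegral_eq_integral_of_forall_compl_eq_zero fun x hx ↦ by rw [hz x hx]; ring).symm
  rw [hB, hN]
  set A := a + Real.sinh a with hA
  have hA0 : 0 < A := by have := Real.sinh_pos_iff.2 ha; positivity
  set B := ∫ t in Icc (-a) a, g t * Real.cosh (t / 2) with hBdef
  set N := ∫ x in Icc (-a) a, g x ^ 2 with hNdef
  -- `0 ≤ ∫_{[−a,a]} (A·g − B·cosh(·/2))² = A(AN − B²)`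
  have hc : Continuous fun t : ℝ ↦ Real.cosh (t / 2) := Real.continuous_cosh.comp (continuous_id.div_const 2)
  have iN : IntegrableOn (fun x ↦ g x ^ 2) (Icc (-a) a) := (hgc.pow 2).continuousOn.integrableOn_Icc
  have iB : IntegrableOn (fun t ↦ g t * Real.cosh (t / 2)) (Icc (-a) a) := (hgc.mul hc).continuousOn.integrableOn_Icc
  have iA : IntegrableOn (fun t ↦ Real.cosh (t / 2) ^ 2) (Icc (-a) a) := (hc.pow 2).continuousOn.integrableOn_Icc
  have hexp : ∫ t in Icc (-a) a, (A * g t - B * Real.cosh (t / 2)) ^ 2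
      = A ^ 2 * N - 2 * A * B * B + B ^ 2 * A := by
    have e : (fun t ↦ (A * g t - B * Real.cosh (t / 2)) ^ 2)
        = fun t ↦ A ^ 2 * g t ^ 2 - 2 * A * B * (g t * Real.cosh (t / 2)) + B ^ 2 * Real.cosh (t / 2) ^ 2 := by
      funext t; ring
    have j1 : IntegrableOn (fun t ↦ A ^ 2 * g t ^ 2) (Icc (-a) a) := iN.const_mul _
    have j2 : IntegrableOn (fun t ↦ 2 * A * B * (g t * Real.cosh (t / 2))) (Icc (-a) a) := iB.const_mul _
    have j3 : IntegrableOn (fun t ↦ B ^ 2 * Real.cosh (t / 2) ^ 2) (Icc (-a) a) := iA.const_mul _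
    have j12 : IntegrableOn (fun t ↦ A ^ 2 * g t ^ 2 - 2 * A * B * (g t * Real.cosh (t / 2))) (Icc (-a) a) := j1.sub j2
    rw [e, integral_add j12 j3, integral_sub j1 j2, integral_const_mul, integral_const_mul, integral_const_mul,
      integral_cosh_half_sq ha.le]
  have hnn : 0 ≤ ∫ t in Icc (-a) a, (A * g t - B * Real.cosh (t / 2)) ^ 2 := integral_nonneg fun t ↦ sq_nonneg _
  rw [hexp] at hnn
  nlinarith

/-- `2(a + sinh a) = e^a + 2a − e^{−a}` (the window constant next to the law's `pntFloor a = e^a + 2a − 2 + o(1)`). -/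
theorem two_mul_add_sinh (a : ℝ) : 2 * (a + Real.sinh a) = Real.exp a + 2 * a - Real.exp (-a) := by
  rw [Real.sinh_eq]; ring

/-- **THE RH CEILING OF THE PRIME-SHIFT FORM**: under RH, for every real smooth `g` supported in `[−a, a]` (`a > 0`),
`Q_a(g) ≤ (e^a + 2a − e^{−a} − 2I₀ − log 4π − γ)‖g‖² + ∫₀^∞ ρ_∞(t) D_t(G) dt − 2(∫ g·sinh(·/2))²`.
Hence the UPPER clause of the floor law C-XIII under RH is exactly an `O(‖g‖²)` bound, uniform in `a`, for the archimedean excess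
`∫₀^∞ ρ_∞(t)(D_t(G) − 2(1 − e^{−t/2})‖g‖²) dt` over near-extremal `g` (note `∫₀^∞ ρ_∞·2(1 − e^{−t/2}) = 2I₀`). -/
theorem primeShiftForm_le_of_RH (hRH : RiemannHypothesis) (hG : IsWeilTest fun x ↦ (g x : ℂ))
    (hsub : tsupport (fun x ↦ (g x : ℂ)) ⊆ Icc (-a) a) (ha : 0 < a) :
    primeShiftForm a g
      ≤ (Real.exp a + 2 * a - Real.exp (-a)
          - (2 * (∫ t in Ioi (0 : ℝ), (Real.exp (t / 2) - 1) / (2 * Real.sinh t))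
            + (Real.log (4 * π) + Real.eulerMascheroniConstant))) * (∫ x, g x ^ 2)
        + (∫ t in Ioi (0 : ℝ), weilArchDensity t * weilIncrement (fun x ↦ (g x : ℂ)) t)
        - 2 * (∫ t, g t * Real.sinh (t / 2)) ^ 2 := by
  have h1 := primeShiftForm_add_le_of_RH hRH hG hsub
  have h2 := sq_integral_mul_cosh_le hG hsub ha
  rw [← two_mul_add_sinh]
  nlinarith [h1, h2]

/-! ## Appendix (gen10 APPEND): §4 the exact anatomy under RH — the dropped term is the zero energy; §5 the ceiling on a bandwidth class

§4 UNDER RH EXACTLY `Q_a(g) = pole − killing + archimedean energy − ∫‖ĝ(½+it)‖²dν` (zero energy; Bochner form of the explicit formula,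
Literature `WeilBochner.weilQuadratic_eq_integral_of_riemannHypothesis`).  §5 on an `L²`-modulus class `D_t(G) ≤ Kt²‖g‖²` (`0 < t ≤ 1`;
e.g. `‖g′‖² ≤ K‖g‖²`) the archimedean energy is `≤ (K·∫_{(0,1]}t²ρ_∞ + 4Φ(1))‖g‖²` (`Φ(1) = weilArchTail 1 = ∫₁^∞ρ_∞ ≈ 1.2486`,
`∫_{(0,1]}t²ρ_∞ ≈ 0.3224`), so UNDER RH the UPPER clause of C-XIII holds UNIFORMLY IN `a` on every such class with a constant affine in `K`
(`primeShiftForm_le_of_RH_of_modulus`): a violation of the upper clause needs near-extremals whose modulus constant is unbounded in `a`. -/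

/-- **UNDER RH, EXACTLY: `Q_a(g) = 2(∫g·cosh(·/2))² − 2(∫g·sinh(·/2))² − (2I₀ + log 4π + γ)‖g‖² + ∫₀^∞ρ_∞D_t(G) − ∫‖ĝ(½+it)‖²dν(t)`**,
`ν` = the zero-height measure `Σ_ρ m(ρ)δ_{Im ρ}` (Literature `WeilBochner.weilQuadratic_eq_integral_of_riemannHypothesis`, Bombieri 2000 (3.2)):
prime-shift form = POLE − KILLING + ARCHIMEDEAN ENERGY − ZERO ENERGY. -/
theorem primeShiftForm_eq_of_RH (hRH : RiemannHypothesis) (hG : IsWeilTest fun x ↦ (g x : ℂ))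
    (hsub : tsupport (fun x ↦ (g x : ℂ)) ⊆ Icc (-a) a) :
    primeShiftForm a g
      = 2 * (∫ t, g t * Real.cosh (t / 2)) ^ 2 - 2 * (∫ t, g t * Real.sinh (t / 2)) ^ 2
        - (2 * (∫ t in Ioi (0 : ℝ), (Real.exp (t / 2) - 1) / (2 * Real.sinh t))
            + (Real.log (4 * π) + Real.eulerMascheroniConstant)) * (∫ x, g x ^ 2)
        + (∫ t in Ioi (0 : ℝ), weilArchDensity t * weilIncrement (fun x ↦ (g x : ℂ)) t)
        - ∫ t : ℝ, ‖weilMellin (fun x ↦ (g x : ℂ)) (1 / 2 + t * Complex.I)‖ ^ 2 ∂WeilBochner.zetaZeroHeightMeasure := by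
  have hZ := (WeilBochner.weilQuadratic_eq_integral_of_riemannHypothesis hRH hG).2
  have hre : (weilQuadratic fun x ↦ (g x : ℂ)).re
      = ∫ t : ℝ, ‖weilMellin (fun x ↦ (g x : ℂ)) (1 / 2 + t * Complex.I)‖ ^ 2 ∂WeilBochner.zetaZeroHeightMeasure := by
    rw [hZ, Complex.ofReal_re]
  rw [weilQuadratic_re_eq_weilPoleForm_add_weilDirichletEnergy_sub hG hsub, weilPoleForm_ofReal] at hre
  have hnorm : (∫ x, ‖((g x : ℂ))‖ ^ 2) = ∫ x, g x ^ 2 :=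
    integral_congr_ae (ae_of_all _ fun x ↦ by simp only [Complex.norm_real, Real.norm_eq_abs, sq_abs])
  rw [hnorm] at hre
  unfold weilDirichletEnergy weilMarkovConstant at hre
  have hQ := primeShiftForm_eq_sum_weilIncrement (a := a) hG
  rw [Finset.mul_sum] at hre
  set N := ∫ x, g x ^ 2 with hN
  set E := ∑ n ∈ weilPrimeIndex a, (Λ n : ℝ) / Real.sqrt n * weilIncrement (fun x ↦ (g x : ℂ)) (Real.log n) with hE
  set P := ∑ n ∈ weilPrimeIndex a, (Λ n : ℝ) / Real.sqrt n with hP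
  have hQ' : primeShiftForm a g = 2 * N * P - E := by
    rw [hQ, hP, hE, Finset.mul_sum, ← Finset.sum_sub_distrib]
    exact Finset.sum_congr rfl fun n _ ↦ by ring
  have hPN : ∑ n ∈ weilPrimeIndex a, 2 * ((Λ n : ℝ) / Real.sqrt n) = 2 * P := by rw [hP, Finset.mul_sum]
  rw [hPN] at hre
  linear_combination hQ' - hre

/-! ## §5 (APPEND, gen10) The RH ceiling on an `L²`-modulus (bandwidth) class -/

/-- `t²ρ_∞(t)` is integrable on `(0, 1]` (it is bounded by `t e^{t/2}/2 ≤ 2` there, `ρ_∞(t) ≤ e^{t/2}/(2t)`). -/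
theorem integrableOn_sq_mul_weilArchDensity : IntegrableOn (fun t : ℝ ↦ t ^ 2 * weilArchDensity t) (Ioc 0 1) := by
  have hc : ContinuousOn (fun t : ℝ ↦ t ^ 2 * weilArchDensity t) (Ioc 0 1) :=
    ((continuousOn_pow 2).mul (continuousOn_weilArchDensity.mono fun t ht ↦ ht.1))
  refine Integrable.mono' (integrableOn_const (C := (2 : ℝ)) (by simp)) (hc.aestronglyMeasurable measurableSet_Ioc) ?_
  refine (ae_restrict_iff' measurableSet_Ioc).2 (ae_of_all _ fun t ht ↦ ?_)
  have ht0 : 0 < t := ht.1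
  have hρ := weilArchDensity_le_exp_half_div ht0
  have hρ0 := (weilArchDensity_pos ht0).le
  have he : Real.exp (t / 2) ≤ Real.exp 1 := Real.exp_le_exp.2 (by linarith [ht.2])
  have he1 := Real.exp_one_lt_d9
  rw [Real.norm_eq_abs, abs_of_nonneg (by positivity)]
  calc t ^ 2 * weilArchDensity t ≤ t ^ 2 * (Real.exp (t / 2) / (2 * t)) := mul_le_mul_of_nonneg_left hρ (sq_nonneg t)
    _ = t * Real.exp (t / 2) / 2 := by field_simp
    _ ≤ 1 * Real.exp 1 / 2 := by gcongr; exact ht.2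
    _ ≤ 2 := by linarith

/-- The archimedean energy on an `L²`-modulus class: if `D_t(G) ≤ K t²‖g‖²` on `(0, 1]`, then
`∫₀^∞ ρ_∞(t) D_t(G) dt ≤ (K·∫_{(0,1]} t²ρ_∞ + 4·Φ(1))·‖g‖²` (`D_t ≤ 4‖g‖²` beyond `t = 1`, `Φ(1) = weilArchTail 1 = ∫₁^∞ ρ_∞`). -/
theorem archEnergy_le_of_modulus (hG : IsWeilTest fun x ↦ (g x : ℂ)) {K : ℝ}
    (hmod : ∀ t ∈ Ioc (0 : ℝ) 1, weilIncrement (fun x ↦ (g x : ℂ)) t ≤ K * t ^ 2 * ∫ x, g x ^ 2) :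
    ∫ t in Ioi (0 : ℝ), weilArchDensity t * weilIncrement (fun x ↦ (g x : ℂ)) t
      ≤ (K * (∫ t in Ioc (0 : ℝ) 1, t ^ 2 * weilArchDensity t) + 4 * weilArchTail 1) * ∫ x, g x ^ 2 := by
  set N := ∫ x, g x ^ 2 with hN
  have hnorm : (∫ x, ‖((g x : ℂ))‖ ^ 2) = N :=
    integral_congr_ae (ae_of_all _ fun x ↦ by simp only [Complex.norm_real, Real.norm_eq_abs, sq_abs])
  have hI := integrableOn_weilArchDensity_mul_weilIncrement hG
  rw [← Ioc_union_Ioi_eq_Ioi zero_le_one, setIntegral_union Ioc_disjoint_Ioi_same measurableSet_Ioi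
    (hI.mono_set Ioc_subset_Ioi_self) (hI.mono_set (Ioi_subset_Ioi zero_le_one))]
  -- the small scales
  have h1 : ∫ t in Ioc (0 : ℝ) 1, weilArchDensity t * weilIncrement (fun x ↦ (g x : ℂ)) t
      ≤ ∫ t in Ioc (0 : ℝ) 1, (K * N) * (t ^ 2 * weilArchDensity t) := by
    refine setIntegral_mono_on (hI.mono_set Ioc_subset_Ioi_self) (integrableOn_sq_mul_weilArchDensity.const_mul _)
      measurableSet_Ioc fun t ht ↦ ?_
    have hρ0 := (weilArchDensity_pos ht.1).le
    calc weilArchDensity t * weilIncrement (fun x ↦ (g x : ℂ)) t ≤ weilArchDensity t * (K * t ^ 2 * N) :=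
          mul_le_mul_of_nonneg_left (hmod t ht) hρ0
      _ = (K * N) * (t ^ 2 * weilArchDensity t) := by ring
  -- the large scales
  have h2 : ∫ t in Ioi (1 : ℝ), weilArchDensity t * weilIncrement (fun x ↦ (g x : ℂ)) t
      ≤ ∫ t in Ioi (1 : ℝ), (4 * N) * weilArchDensity t := by
    refine setIntegral_mono_on (hI.mono_set (Ioi_subset_Ioi zero_le_one))
      ((integrableOn_weilArchDensity_Ioi one_pos).const_mul _) measurableSet_Ioi fun t ht ↦ ?_
    have ht0 : (0 : ℝ) < t := lt_trans one_pos ht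
    have hρ0 := (weilArchDensity_pos ht0).le
    have hD := weilIncrement_le hG t
    rw [hnorm] at hD
    calc weilArchDensity t * weilIncrement (fun x ↦ (g x : ℂ)) t ≤ weilArchDensity t * (4 * N) :=
          mul_le_mul_of_nonneg_left hD hρ0
      _ = (4 * N) * weilArchDensity t := by ring
  rw [integral_const_mul] at h1 h2
  unfold weilArchTail
  linarith

/-- **THE RH CEILING ON AN `L²`-MODULUS CLASS**: under RH, for every real smooth `g` supported in `[−a, a]` (`a > 0`) with
`D_t(G) ≤ K t²‖g‖²` for `0 < t ≤ 1`,
`Q_a(g) ≤ (e^a + 2a − e^{−a} − 2I₀ − log 4π − γ + K·∫_{(0,1]} t²ρ_∞ + 4·Φ(1))·‖g‖²` — the UPPER clause of the floor law holds uniformly in `a`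
on the class, with a constant affine in `K`. -/
theorem primeShiftForm_le_of_RH_of_modulus (hRH : RiemannHypothesis) (hG : IsWeilTest fun x ↦ (g x : ℂ))
    (hsub : tsupport (fun x ↦ (g x : ℂ)) ⊆ Icc (-a) a) (ha : 0 < a) {K : ℝ}
    (hmod : ∀ t ∈ Ioc (0 : ℝ) 1, weilIncrement (fun x ↦ (g x : ℂ)) t ≤ K * t ^ 2 * ∫ x, g x ^ 2) :
    primeShiftForm a g
      ≤ (Real.exp a + 2 * a - Real.exp (-a)
          - (2 * (∫ t in Ioi (0 : ℝ), (Real.exp (t / 2) - 1) / (2 * Real.sinh t))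
            + (Real.log (4 * π) + Real.eulerMascheroniConstant))
          + (K * (∫ t in Ioc (0 : ℝ) 1, t ^ 2 * weilArchDensity t) + 4 * weilArchTail 1)) * (∫ x, g x ^ 2) := by
  have h1 := primeShiftForm_le_of_RH hRH hG hsub ha
  have h2 := archEnergy_le_of_modulus hG hmod
  nlinarith [h1, h2, sq_nonneg (∫ t, g t * Real.sinh (t / 2))]


/-! ## Appendix 2 (gen10 APPEND): §6 the killing constant in closed form — minus the archimedean symbol at frequency `0` -/

/-- **The killing constant in closed form**: `2I₀ + log 4π + γ = γ + π/2 + 3 log 2 + log π` (`= 5.3722…`), by the tree's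
`GroundStateSimpleEven.kill_integral_weilKillingDensity_eq` (`I₀ = ∫₀^∞ (e^{t/2} − 1)/(2 sinh t) dt = π/4 + ½ log 2`). -/
theorem killingConstant_eq :
    2 * (∫ t in Ioi (0 : ℝ), (Real.exp (t / 2) - 1) / (2 * Real.sinh t)) + (Real.log (4 * π) + Real.eulerMascheroniConstant)
      = Real.eulerMascheroniConstant + π / 2 + 3 * Real.log 2 + Real.log π := by
  rw [GroundStateSimpleEven.kill_integral_weilKillingDensity_eq, show (4 : ℝ) * π = 2 ^ 2 * π by ring,
    Real.log_mul (by positivity) Real.pi_pos.ne', Real.log_pow]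
  push_cast
  ring

/-- **The killing constant is minus the archimedean symbol of the explicit formula at frequency `0`**:
`2I₀ + log 4π + γ = −(Re ψ(¼) − log π)` (Gauss's `ψ(¼) = −γ − π/2 − 3 log 2`, Literature `digamma_one_quarter`); here
`Re ψ(¼ + it/2) − log π` is the density of `weilArchTerm` (Literature `WeilExplicit`).  So under RH the ceiling of
`primeShiftForm_le_of_RH` reads `Q_a(g) ≤ (e^a + 2a − e^{−a} + Re ψ(¼) − log π)‖g‖² + ∫₀^∞ρ_∞D_t(G) − 2⟨g,sinh(·/2)⟩²`. -/
theorem killingConstant_eq_neg_archSymbol_zero :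
    2 * (∫ t in Ioi (0 : ℝ), (Real.exp (t / 2) - 1) / (2 * Real.sinh t)) + (Real.log (4 * π) + Real.eulerMascheroniConstant)
      = -((Complex.digamma (1 / 4)).re - Real.log π) := by
  rw [killingConstant_eq, Literature.Analysis.SpecialFunctions.Complex.digamma_one_quarter,
    show Complex.log 2 = ((Real.log 2 : ℝ) : ℂ) by rw [show (2 : ℂ) = ((2 : ℝ) : ℂ) by norm_num, Complex.ofReal_log (by norm_num)]]
  simp only [Complex.sub_re, Complex.neg_re, Complex.ofReal_re, Complex.mul_re, Complex.div_re, Complex.re_ofNat,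
    Complex.im_ofNat, Complex.ofReal_im]
  norm_num
  ring


end FloorAnatomy

end Summit.RiemannHypothesis.RiemannHypothesis.Theorems.WeilFormatC
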